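import Summits.Ventures.WeilGRH.CensusTwoPrimeRungs2
import HarnessLib

/-!
# GRH arm (rh-explicit, venture WeilGRH): values `2 − 2cos(2πE/ord) = ‖1 − χ(k)‖²` for the census characters

Cell `rh-explicit`, WEIL TRACK — GRH ARM, seat weil-grh-2 (gen3). For a census character `χ = (censusRow q n).toChar _`
and a unit `k`, `χ(k) = e^{2πi E[k]/ord}` (`censusRow_toChar_natCast`), so `‖1 − χ(k)‖² = 2 − 2cos(2π E[k]/ord)`
(`normSq_one_sub_censusChar`). This file evaluates `2 − 2cos(2πE/O)` for the pairs `(E, O)` met at `k = 2, 3` in the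
census of conductor `≤ 20`: exactly (`2, 3, 4` at the angles `π/2, 3π/2, 2π/3, 4π/3, π`) or inside a box of width
`≈ 3·10⁻⁴` (`2 ∓ √2`, `2 + √3`, `(5 ∓ √5)/2`, `(3 + √5)/2`, `2 ∓ 2cos(π/8)`, `2 ∓ 2sin(π/8)`), from Mathlib's
`cos_pi_div_three/four/five/six/eight`, `sin_pi_div_eight` and rational bounds on `√2, √3, √5, √(2 ± √2)`.
Consumers: `CensusDoubleReflection*.lean`. No named facts.
-/

noncomputable section

open Complex
open scoped Real ComplexConjugate

namespace Summit.Ventures.WeilGRH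

open Literature.NumberTheory.LFunctions

/-! ## Bridge helpers -/

/-- `(2 : ZMod q)` is the cast of the natural number `2`. [folklore] -/
theorem two_eq_natCast'' (q : ℕ) : (2 : ZMod q) = ((2 : ℕ) : ZMod q) := by norm_cast

/-- `(3 : ZMod q)` is the cast of the natural number `3`. [folklore] -/
theorem three_eq_natCast'' (q : ℕ) : (3 : ZMod q) = ((3 : ℕ) : ZMod q) := by norm_cast

/-- A census character vanishes at the non-units. [folklore] -/
theorem censusRow_toChar_natCast_eq_zero {q n : ℕ} (h : (censusRow q n).check = true) (k : ℕ)
    (hk : ¬ Nat.Coprime k (censusRow q n).q) :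
    (censusRow q n).toChar h (k : ZMod (censusRow q n).q) = 0 := by
  rw [ConreyRow.toChar_apply_natCast, if_neg hk]

/-- A census character is `1` at a unit `k` with exponent `E[k] = 0`. [folklore] -/
theorem censusRow_toChar_natCast_eq_one {q n : ℕ} (h : (censusRow q n).check = true) (k : ℕ)
    (hk : Nat.Coprime k (censusRow q n).q) (he : (censusRow q n).e k = 0) :
    (censusRow q n).toChar h (k : ZMod (censusRow q n).q) = 1 := by
  rw [ConreyRow.toChar_apply_natCast, if_pos hk, he, pow_zero]

/-- `‖1 − χ(k)‖² = 2 − 2cos(2π E[k]/ord)` for a census character at a unit `k`. [folklore] -/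
theorem normSq_one_sub_censusChar {q n : ℕ} (h : (censusRow q n).check = true) (k : ℕ)
    (hk : Nat.Coprime k (censusRow q n).q) :
    ‖1 - (censusRow q n).toChar h (k : ZMod (censusRow q n).q)‖ ^ 2 =
      2 - 2 * Real.cos (2 * π * (censusRow q n).e k / (censusRow q n).ord) := by
  rw [censusRow_toChar_natCast h k hk, normSq_one_sub_cexp_mul_I]

/-! ## Square-root bounds -/

/-- `2.236 < √5 < 2.2361`. [folklore] -/
theorem sqrt_five_bounds : (2.236 : ℝ) < Real.sqrt 5 ∧ Real.sqrt 5 < 2.2361 :=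
  ⟨(Real.lt_sqrt (by norm_num)).2 (by norm_num), (Real.sqrt_lt' (by norm_num)).2 (by norm_num)⟩

/-- `1.8476 < √(2 + √2) < 1.8479` (`= 2cos(π/8)`). [folklore] -/
theorem sqrt_two_add_sqrt_two_bounds :
    (1.8476 : ℝ) < Real.sqrt (2 + Real.sqrt 2) ∧ Real.sqrt (2 + Real.sqrt 2) < 1.8479 := by
  obtain ⟨h1, h2⟩ := sqrt_two_bounds
  exact ⟨(Real.lt_sqrt (by norm_num)).2 (by nlinarith), (Real.sqrt_lt' (by norm_num)).2 (by nlinarith)⟩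

/-- `0.7652 < √(2 − √2) < 0.7655` (`= 2sin(π/8)`). [folklore] -/
theorem sqrt_two_sub_sqrt_two_bounds :
    (0.7652 : ℝ) < Real.sqrt (2 - Real.sqrt 2) ∧ Real.sqrt (2 - Real.sqrt 2) < 0.7655 := by
  obtain ⟨h1, h2⟩ := sqrt_two_bounds
  exact ⟨(Real.lt_sqrt (by norm_num)).2 (by nlinarith), (Real.sqrt_lt' (by norm_num)).2 (by nlinarith)⟩

/-! ## The values `2 − 2cos(2πE/O)` -/

/-- `2 − 2cos(2π·1/2) = 4`. [folklore] -/
theorem twoSubTwoCos_1_2 :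
    2 - 2 * Real.cos (2 * π * ((1 : ℕ) : ℝ) / ((2 : ℕ) : ℝ)) = 4 := by
  rw [show (2 * π * ((1 : ℕ) : ℝ) / ((2 : ℕ) : ℝ) : ℝ) = π by push_cast; ring, Real.cos_pi]
  norm_num

/-- `2 − 2cos(2π·1/3) = 3`. [folklore] -/
theorem twoSubTwoCos_1_3 :
    2 - 2 * Real.cos (2 * π * ((1 : ℕ) : ℝ) / ((3 : ℕ) : ℝ)) = 3 := by
  rw [show (2 * π * ((1 : ℕ) : ℝ) / ((3 : ℕ) : ℝ) : ℝ) = π - π / 3 by push_cast; ring, Real.cos_pi_sub, Real.cos_pi_div_three]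
  norm_num

/-- `2 − 2cos(2π·2/3) = 3`. [folklore] -/
theorem twoSubTwoCos_2_3 :
    2 - 2 * Real.cos (2 * π * ((2 : ℕ) : ℝ) / ((3 : ℕ) : ℝ)) = 3 := by
  rw [show (2 * π * ((2 : ℕ) : ℝ) / ((3 : ℕ) : ℝ) : ℝ) = π / 3 + π by push_cast; ring, Real.cos_add_pi, Real.cos_pi_div_three]
  norm_num

/-- `2 − 2cos(2π·1/4) = 2`. [folklore] -/
theorem twoSubTwoCos_1_4 :
    2 - 2 * Real.cos (2 * π * ((1 : ℕ) : ℝ) / ((4 : ℕ) : ℝ)) = 2 := by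
  rw [show (2 * π * ((1 : ℕ) : ℝ) / ((4 : ℕ) : ℝ) : ℝ) = π / 2 by push_cast; ring, Real.cos_pi_div_two]
  norm_num

/-- `2 − 2cos(2π·2/4) = 4`. [folklore] -/
theorem twoSubTwoCos_2_4 :
    2 - 2 * Real.cos (2 * π * ((2 : ℕ) : ℝ) / ((4 : ℕ) : ℝ)) = 4 := by
  rw [show (2 * π * ((2 : ℕ) : ℝ) / ((4 : ℕ) : ℝ) : ℝ) = π by push_cast; ring, Real.cos_pi]
  norm_num

/-- `2 − 2cos(2π·3/4) = 2`. [folklore] -/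
theorem twoSubTwoCos_3_4 :
    2 - 2 * Real.cos (2 * π * ((3 : ℕ) : ℝ) / ((4 : ℕ) : ℝ)) = 2 := by
  rw [show (2 * π * ((3 : ℕ) : ℝ) / ((4 : ℕ) : ℝ) : ℝ) = π / 2 + π by push_cast; ring, Real.cos_add_pi, Real.cos_pi_div_two]
  norm_num

/-- `2 − 2cos(2π·1/5) = 1.381966… ∈ [1.3818, 1.3821]`. [folklore] -/
theorem twoSubTwoCos_1_5 :
    (1.3818 : ℝ) ≤ 2 - 2 * Real.cos (2 * π * ((1 : ℕ) : ℝ) / ((5 : ℕ) : ℝ)) ∧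
    2 - 2 * Real.cos (2 * π * ((1 : ℕ) : ℝ) / ((5 : ℕ) : ℝ)) ≤ 1.3821 := by
  rw [show (2 * π * ((1 : ℕ) : ℝ) / ((5 : ℕ) : ℝ) : ℝ) = 2 * (π / 5) by push_cast; ring, Real.cos_two_mul, Real.cos_pi_div_five]
  constructor <;> nlinarith [sqrt_five_bounds.1, sqrt_five_bounds.2, Real.mul_self_sqrt (show (0:ℝ) ≤ 5 by norm_num)]

/-- `2 − 2cos(2π·2/5) = 3.618034… ∈ [3.6179, 3.6182]`. [folklore] -/
theorem twoSubTwoCos_2_5 :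
    (3.6179 : ℝ) ≤ 2 - 2 * Real.cos (2 * π * ((2 : ℕ) : ℝ) / ((5 : ℕ) : ℝ)) ∧
    2 - 2 * Real.cos (2 * π * ((2 : ℕ) : ℝ) / ((5 : ℕ) : ℝ)) ≤ 3.6182 := by
  rw [show (2 * π * ((2 : ℕ) : ℝ) / ((5 : ℕ) : ℝ) : ℝ) = π - π / 5 by push_cast; ring, Real.cos_pi_sub, Real.cos_pi_div_five]
  constructor <;> nlinarith [sqrt_five_bounds.1, sqrt_five_bounds.2]

/-- `2 − 2cos(2π·3/5) = 3.618034… ∈ [3.6179, 3.6182]`. [folklore] -/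
theorem twoSubTwoCos_3_5 :
    (3.6179 : ℝ) ≤ 2 - 2 * Real.cos (2 * π * ((3 : ℕ) : ℝ) / ((5 : ℕ) : ℝ)) ∧
    2 - 2 * Real.cos (2 * π * ((3 : ℕ) : ℝ) / ((5 : ℕ) : ℝ)) ≤ 3.6182 := by
  rw [show (2 * π * ((3 : ℕ) : ℝ) / ((5 : ℕ) : ℝ) : ℝ) = π / 5 + π by push_cast; ring, Real.cos_add_pi, Real.cos_pi_div_five]
  constructor <;> nlinarith [sqrt_five_bounds.1, sqrt_five_bounds.2]

/-- `2 − 2cos(2π·4/5) = 1.381966… ∈ [1.3818, 1.3821]`. [folklore] -/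
theorem twoSubTwoCos_4_5 :
    (1.3818 : ℝ) ≤ 2 - 2 * Real.cos (2 * π * ((4 : ℕ) : ℝ) / ((5 : ℕ) : ℝ)) ∧
    2 - 2 * Real.cos (2 * π * ((4 : ℕ) : ℝ) / ((5 : ℕ) : ℝ)) ≤ 1.3821 := by
  rw [show (2 * π * ((4 : ℕ) : ℝ) / ((5 : ℕ) : ℝ) : ℝ) = 2 * π - 2 * (π / 5) by push_cast; ring, Real.cos_two_pi_sub, Real.cos_two_mul, Real.cos_pi_div_five]
  constructor <;> nlinarith [sqrt_five_bounds.1, sqrt_five_bounds.2, Real.mul_self_sqrt (show (0:ℝ) ≤ 5 by norm_num)]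

/-- `2 − 2cos(2π·1/8) = 0.585786… ∈ [0.5856, 0.5859]`. [folklore] -/
theorem twoSubTwoCos_1_8 :
    (0.5856 : ℝ) ≤ 2 - 2 * Real.cos (2 * π * ((1 : ℕ) : ℝ) / ((8 : ℕ) : ℝ)) ∧
    2 - 2 * Real.cos (2 * π * ((1 : ℕ) : ℝ) / ((8 : ℕ) : ℝ)) ≤ 0.5859 := by
  rw [show (2 * π * ((1 : ℕ) : ℝ) / ((8 : ℕ) : ℝ) : ℝ) = π / 4 by push_cast; ring, Real.cos_pi_div_four]
  constructor <;> nlinarith [sqrt_two_bounds.1, sqrt_two_bounds.2]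

/-- `2 − 2cos(2π·2/8) = 2`. [folklore] -/
theorem twoSubTwoCos_2_8 :
    2 - 2 * Real.cos (2 * π * ((2 : ℕ) : ℝ) / ((8 : ℕ) : ℝ)) = 2 := by
  rw [show (2 * π * ((2 : ℕ) : ℝ) / ((8 : ℕ) : ℝ) : ℝ) = π / 2 by push_cast; ring, Real.cos_pi_div_two]
  norm_num

/-- `2 − 2cos(2π·3/8) = 3.414214… ∈ [3.4141, 3.4144]`. [folklore] -/
theorem twoSubTwoCos_3_8 :
    (3.4141 : ℝ) ≤ 2 - 2 * Real.cos (2 * π * ((3 : ℕ) : ℝ) / ((8 : ℕ) : ℝ)) ∧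
    2 - 2 * Real.cos (2 * π * ((3 : ℕ) : ℝ) / ((8 : ℕ) : ℝ)) ≤ 3.4144 := by
  rw [show (2 * π * ((3 : ℕ) : ℝ) / ((8 : ℕ) : ℝ) : ℝ) = π - π / 4 by push_cast; ring, Real.cos_pi_sub, Real.cos_pi_div_four]
  constructor <;> nlinarith [sqrt_two_bounds.1, sqrt_two_bounds.2]

/-- `2 − 2cos(2π·5/8) = 3.414214… ∈ [3.4141, 3.4144]`. [folklore] -/
theorem twoSubTwoCos_5_8 :
    (3.4141 : ℝ) ≤ 2 - 2 * Real.cos (2 * π * ((5 : ℕ) : ℝ) / ((8 : ℕ) : ℝ)) ∧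
    2 - 2 * Real.cos (2 * π * ((5 : ℕ) : ℝ) / ((8 : ℕ) : ℝ)) ≤ 3.4144 := by
  rw [show (2 * π * ((5 : ℕ) : ℝ) / ((8 : ℕ) : ℝ) : ℝ) = π / 4 + π by push_cast; ring, Real.cos_add_pi, Real.cos_pi_div_four]
  constructor <;> nlinarith [sqrt_two_bounds.1, sqrt_two_bounds.2]

/-- `2 − 2cos(2π·6/8) = 2`. [folklore] -/
theorem twoSubTwoCos_6_8 :
    2 - 2 * Real.cos (2 * π * ((6 : ℕ) : ℝ) / ((8 : ℕ) : ℝ)) = 2 := by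
  rw [show (2 * π * ((6 : ℕ) : ℝ) / ((8 : ℕ) : ℝ) : ℝ) = π / 2 + π by push_cast; ring, Real.cos_add_pi, Real.cos_pi_div_two]
  norm_num

/-- `2 − 2cos(2π·7/8) = 0.585786… ∈ [0.5856, 0.5859]`. [folklore] -/
theorem twoSubTwoCos_7_8 :
    (0.5856 : ℝ) ≤ 2 - 2 * Real.cos (2 * π * ((7 : ℕ) : ℝ) / ((8 : ℕ) : ℝ)) ∧
    2 - 2 * Real.cos (2 * π * ((7 : ℕ) : ℝ) / ((8 : ℕ) : ℝ)) ≤ 0.5859 := by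
  rw [show (2 * π * ((7 : ℕ) : ℝ) / ((8 : ℕ) : ℝ) : ℝ) = 2 * π - π / 4 by push_cast; ring, Real.cos_two_pi_sub, Real.cos_pi_div_four]
  constructor <;> nlinarith [sqrt_two_bounds.1, sqrt_two_bounds.2]

/-- `2 − 2cos(2π·3/10) = 2.618034… ∈ [2.6179, 2.6182]`. [folklore] -/
theorem twoSubTwoCos_3_10 :
    (2.6179 : ℝ) ≤ 2 - 2 * Real.cos (2 * π * ((3 : ℕ) : ℝ) / ((10 : ℕ) : ℝ)) ∧
    2 - 2 * Real.cos (2 * π * ((3 : ℕ) : ℝ) / ((10 : ℕ) : ℝ)) ≤ 2.6182 := by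
  rw [show (2 * π * ((3 : ℕ) : ℝ) / ((10 : ℕ) : ℝ) : ℝ) = π - 2 * (π / 5) by push_cast; ring, Real.cos_pi_sub, Real.cos_two_mul, Real.cos_pi_div_five]
  constructor <;> nlinarith [sqrt_five_bounds.1, sqrt_five_bounds.2, Real.mul_self_sqrt (show (0:ℝ) ≤ 5 by norm_num)]

/-- `2 − 2cos(2π·4/10) = 3.618034… ∈ [3.6179, 3.6182]`. [folklore] -/
theorem twoSubTwoCos_4_10 :
    (3.6179 : ℝ) ≤ 2 - 2 * Real.cos (2 * π * ((4 : ℕ) : ℝ) / ((10 : ℕ) : ℝ)) ∧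
    2 - 2 * Real.cos (2 * π * ((4 : ℕ) : ℝ) / ((10 : ℕ) : ℝ)) ≤ 3.6182 := by
  rw [show (2 * π * ((4 : ℕ) : ℝ) / ((10 : ℕ) : ℝ) : ℝ) = π - π / 5 by push_cast; ring, Real.cos_pi_sub, Real.cos_pi_div_five]
  constructor <;> nlinarith [sqrt_five_bounds.1, sqrt_five_bounds.2]

/-- `2 − 2cos(2π·6/10) = 3.618034… ∈ [3.6179, 3.6182]`. [folklore] -/
theorem twoSubTwoCos_6_10 :
    (3.6179 : ℝ) ≤ 2 - 2 * Real.cos (2 * π * ((6 : ℕ) : ℝ) / ((10 : ℕ) : ℝ)) ∧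
    2 - 2 * Real.cos (2 * π * ((6 : ℕ) : ℝ) / ((10 : ℕ) : ℝ)) ≤ 3.6182 := by
  rw [show (2 * π * ((6 : ℕ) : ℝ) / ((10 : ℕ) : ℝ) : ℝ) = π / 5 + π by push_cast; ring, Real.cos_add_pi, Real.cos_pi_div_five]
  constructor <;> nlinarith [sqrt_five_bounds.1, sqrt_five_bounds.2]

/-- `2 − 2cos(2π·7/10) = 2.618034… ∈ [2.6179, 2.6182]`. [folklore] -/
theorem twoSubTwoCos_7_10 :
    (2.6179 : ℝ) ≤ 2 - 2 * Real.cos (2 * π * ((7 : ℕ) : ℝ) / ((10 : ℕ) : ℝ)) ∧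
    2 - 2 * Real.cos (2 * π * ((7 : ℕ) : ℝ) / ((10 : ℕ) : ℝ)) ≤ 2.6182 := by
  rw [show (2 * π * ((7 : ℕ) : ℝ) / ((10 : ℕ) : ℝ) : ℝ) = 2 * (π / 5) + π by push_cast; ring, Real.cos_add_pi, Real.cos_two_mul, Real.cos_pi_div_five]
  constructor <;> nlinarith [sqrt_five_bounds.1, sqrt_five_bounds.2, Real.mul_self_sqrt (show (0:ℝ) ≤ 5 by norm_num)]

/-- `2 − 2cos(2π·4/12) = 3`. [folklore] -/
theorem twoSubTwoCos_4_12 :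
    2 - 2 * Real.cos (2 * π * ((4 : ℕ) : ℝ) / ((12 : ℕ) : ℝ)) = 3 := by
  rw [show (2 * π * ((4 : ℕ) : ℝ) / ((12 : ℕ) : ℝ) : ℝ) = π - π / 3 by push_cast; ring, Real.cos_pi_sub, Real.cos_pi_div_three]
  norm_num

/-- `2 − 2cos(2π·5/12) = 3.732051… ∈ [3.7319, 3.7322]`. [folklore] -/
theorem twoSubTwoCos_5_12 :
    (3.7319 : ℝ) ≤ 2 - 2 * Real.cos (2 * π * ((5 : ℕ) : ℝ) / ((12 : ℕ) : ℝ)) ∧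
    2 - 2 * Real.cos (2 * π * ((5 : ℕ) : ℝ) / ((12 : ℕ) : ℝ)) ≤ 3.7322 := by
  rw [show (2 * π * ((5 : ℕ) : ℝ) / ((12 : ℕ) : ℝ) : ℝ) = π - π / 6 by push_cast; ring, Real.cos_pi_sub, Real.cos_pi_div_six]
  constructor <;> nlinarith [sqrt_three_bounds.1, sqrt_three_bounds.2]

/-- `2 − 2cos(2π·7/12) = 3.732051… ∈ [3.7319, 3.7322]`. [folklore] -/
theorem twoSubTwoCos_7_12 :
    (3.7319 : ℝ) ≤ 2 - 2 * Real.cos (2 * π * ((7 : ℕ) : ℝ) / ((12 : ℕ) : ℝ)) ∧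
    2 - 2 * Real.cos (2 * π * ((7 : ℕ) : ℝ) / ((12 : ℕ) : ℝ)) ≤ 3.7322 := by
  rw [show (2 * π * ((7 : ℕ) : ℝ) / ((12 : ℕ) : ℝ) : ℝ) = π / 6 + π by push_cast; ring, Real.cos_add_pi, Real.cos_pi_div_six]
  constructor <;> nlinarith [sqrt_three_bounds.1, sqrt_three_bounds.2]

/-- `2 − 2cos(2π·8/12) = 3`. [folklore] -/
theorem twoSubTwoCos_8_12 :
    2 - 2 * Real.cos (2 * π * ((8 : ℕ) : ℝ) / ((12 : ℕ) : ℝ)) = 3 := by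
  rw [show (2 * π * ((8 : ℕ) : ℝ) / ((12 : ℕ) : ℝ) : ℝ) = π / 3 + π by push_cast; ring, Real.cos_add_pi, Real.cos_pi_div_three]
  norm_num

/-- `2 − 2cos(2π·1/16) = 0.152241… ∈ [0.1521, 0.1524]`. [folklore] -/
theorem twoSubTwoCos_1_16 :
    (0.1521 : ℝ) ≤ 2 - 2 * Real.cos (2 * π * ((1 : ℕ) : ℝ) / ((16 : ℕ) : ℝ)) ∧
    2 - 2 * Real.cos (2 * π * ((1 : ℕ) : ℝ) / ((16 : ℕ) : ℝ)) ≤ 0.1524 := by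
  rw [show (2 * π * ((1 : ℕ) : ℝ) / ((16 : ℕ) : ℝ) : ℝ) = π / 8 by push_cast; ring, Real.cos_pi_div_eight]
  constructor <;> nlinarith [sqrt_two_add_sqrt_two_bounds.1, sqrt_two_add_sqrt_two_bounds.2]

/-- `2 − 2cos(2π·2/16) = 0.585786… ∈ [0.5856, 0.5859]`. [folklore] -/
theorem twoSubTwoCos_2_16 :
    (0.5856 : ℝ) ≤ 2 - 2 * Real.cos (2 * π * ((2 : ℕ) : ℝ) / ((16 : ℕ) : ℝ)) ∧
    2 - 2 * Real.cos (2 * π * ((2 : ℕ) : ℝ) / ((16 : ℕ) : ℝ)) ≤ 0.5859 := by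
  rw [show (2 * π * ((2 : ℕ) : ℝ) / ((16 : ℕ) : ℝ) : ℝ) = π / 4 by push_cast; ring, Real.cos_pi_div_four]
  constructor <;> nlinarith [sqrt_two_bounds.1, sqrt_two_bounds.2]

/-- `2 − 2cos(2π·3/16) = 1.234633… ∈ [1.2345, 1.2348]`. [folklore] -/
theorem twoSubTwoCos_3_16 :
    (1.2345 : ℝ) ≤ 2 - 2 * Real.cos (2 * π * ((3 : ℕ) : ℝ) / ((16 : ℕ) : ℝ)) ∧
    2 - 2 * Real.cos (2 * π * ((3 : ℕ) : ℝ) / ((16 : ℕ) : ℝ)) ≤ 1.2348 := by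
  rw [show (2 * π * ((3 : ℕ) : ℝ) / ((16 : ℕ) : ℝ) : ℝ) = π / 2 - π / 8 by push_cast; ring, Real.cos_pi_div_two_sub, Real.sin_pi_div_eight]
  constructor <;> nlinarith [sqrt_two_sub_sqrt_two_bounds.1, sqrt_two_sub_sqrt_two_bounds.2]

/-- `2 − 2cos(2π·5/16) = 2.765367… ∈ [2.7652, 2.7655]`. [folklore] -/
theorem twoSubTwoCos_5_16 :
    (2.7652 : ℝ) ≤ 2 - 2 * Real.cos (2 * π * ((5 : ℕ) : ℝ) / ((16 : ℕ) : ℝ)) ∧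
    2 - 2 * Real.cos (2 * π * ((5 : ℕ) : ℝ) / ((16 : ℕ) : ℝ)) ≤ 2.7655 := by
  rw [show (2 * π * ((5 : ℕ) : ℝ) / ((16 : ℕ) : ℝ) : ℝ) = π - (π / 2 - π / 8) by push_cast; ring, Real.cos_pi_sub, Real.cos_pi_div_two_sub, Real.sin_pi_div_eight]
  constructor <;> nlinarith [sqrt_two_sub_sqrt_two_bounds.1, sqrt_two_sub_sqrt_two_bounds.2]

/-- `2 − 2cos(2π·6/16) = 3.414214… ∈ [3.4141, 3.4144]`. [folklore] -/
theorem twoSubTwoCos_6_16 :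
    (3.4141 : ℝ) ≤ 2 - 2 * Real.cos (2 * π * ((6 : ℕ) : ℝ) / ((16 : ℕ) : ℝ)) ∧
    2 - 2 * Real.cos (2 * π * ((6 : ℕ) : ℝ) / ((16 : ℕ) : ℝ)) ≤ 3.4144 := by
  rw [show (2 * π * ((6 : ℕ) : ℝ) / ((16 : ℕ) : ℝ) : ℝ) = π - π / 4 by push_cast; ring, Real.cos_pi_sub, Real.cos_pi_div_four]
  constructor <;> nlinarith [sqrt_two_bounds.1, sqrt_two_bounds.2]

/-- `2 − 2cos(2π·7/16) = 3.847759… ∈ [3.8476, 3.8479]`. [folklore] -/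
theorem twoSubTwoCos_7_16 :
    (3.8476 : ℝ) ≤ 2 - 2 * Real.cos (2 * π * ((7 : ℕ) : ℝ) / ((16 : ℕ) : ℝ)) ∧
    2 - 2 * Real.cos (2 * π * ((7 : ℕ) : ℝ) / ((16 : ℕ) : ℝ)) ≤ 3.8479 := by
  rw [show (2 * π * ((7 : ℕ) : ℝ) / ((16 : ℕ) : ℝ) : ℝ) = π - π / 8 by push_cast; ring, Real.cos_pi_sub, Real.cos_pi_div_eight]
  constructor <;> nlinarith [sqrt_two_add_sqrt_two_bounds.1, sqrt_two_add_sqrt_two_bounds.2]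

/-- `2 − 2cos(2π·9/16) = 3.847759… ∈ [3.8476, 3.8479]`. [folklore] -/
theorem twoSubTwoCos_9_16 :
    (3.8476 : ℝ) ≤ 2 - 2 * Real.cos (2 * π * ((9 : ℕ) : ℝ) / ((16 : ℕ) : ℝ)) ∧
    2 - 2 * Real.cos (2 * π * ((9 : ℕ) : ℝ) / ((16 : ℕ) : ℝ)) ≤ 3.8479 := by
  rw [show (2 * π * ((9 : ℕ) : ℝ) / ((16 : ℕ) : ℝ) : ℝ) = π / 8 + π by push_cast; ring, Real.cos_add_pi, Real.cos_pi_div_eight]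
  constructor <;> nlinarith [sqrt_two_add_sqrt_two_bounds.1, sqrt_two_add_sqrt_two_bounds.2]

/-- `2 − 2cos(2π·10/16) = 3.414214… ∈ [3.4141, 3.4144]`. [folklore] -/
theorem twoSubTwoCos_10_16 :
    (3.4141 : ℝ) ≤ 2 - 2 * Real.cos (2 * π * ((10 : ℕ) : ℝ) / ((16 : ℕ) : ℝ)) ∧
    2 - 2 * Real.cos (2 * π * ((10 : ℕ) : ℝ) / ((16 : ℕ) : ℝ)) ≤ 3.4144 := by
  rw [show (2 * π * ((10 : ℕ) : ℝ) / ((16 : ℕ) : ℝ) : ℝ) = π / 4 + π by push_cast; ring, Real.cos_add_pi, Real.cos_pi_div_four]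
  constructor <;> nlinarith [sqrt_two_bounds.1, sqrt_two_bounds.2]

/-- `2 − 2cos(2π·11/16) = 2.765367… ∈ [2.7652, 2.7655]`. [folklore] -/
theorem twoSubTwoCos_11_16 :
    (2.7652 : ℝ) ≤ 2 - 2 * Real.cos (2 * π * ((11 : ℕ) : ℝ) / ((16 : ℕ) : ℝ)) ∧
    2 - 2 * Real.cos (2 * π * ((11 : ℕ) : ℝ) / ((16 : ℕ) : ℝ)) ≤ 2.7655 := by
  rw [show (2 * π * ((11 : ℕ) : ℝ) / ((16 : ℕ) : ℝ) : ℝ) = (π / 2 - π / 8) + π by push_cast; ring, Real.cos_add_pi, Real.cos_pi_div_two_sub, Real.sin_pi_div_eight]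
  constructor <;> nlinarith [sqrt_two_sub_sqrt_two_bounds.1, sqrt_two_sub_sqrt_two_bounds.2]

/-- `2 − 2cos(2π·13/16) = 1.234633… ∈ [1.2345, 1.2348]`. [folklore] -/
theorem twoSubTwoCos_13_16 :
    (1.2345 : ℝ) ≤ 2 - 2 * Real.cos (2 * π * ((13 : ℕ) : ℝ) / ((16 : ℕ) : ℝ)) ∧
    2 - 2 * Real.cos (2 * π * ((13 : ℕ) : ℝ) / ((16 : ℕ) : ℝ)) ≤ 1.2348 := by
  rw [show (2 * π * ((13 : ℕ) : ℝ) / ((16 : ℕ) : ℝ) : ℝ) = 2 * π - (π / 2 - π / 8) by push_cast; ring, Real.cos_two_pi_sub, Real.cos_pi_div_two_sub, Real.sin_pi_div_eight]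
  constructor <;> nlinarith [sqrt_two_sub_sqrt_two_bounds.1, sqrt_two_sub_sqrt_two_bounds.2]

/-- `2 − 2cos(2π·14/16) = 0.585786… ∈ [0.5856, 0.5859]`. [folklore] -/
theorem twoSubTwoCos_14_16 :
    (0.5856 : ℝ) ≤ 2 - 2 * Real.cos (2 * π * ((14 : ℕ) : ℝ) / ((16 : ℕ) : ℝ)) ∧
    2 - 2 * Real.cos (2 * π * ((14 : ℕ) : ℝ) / ((16 : ℕ) : ℝ)) ≤ 0.5859 := by
  rw [show (2 * π * ((14 : ℕ) : ℝ) / ((16 : ℕ) : ℝ) : ℝ) = 2 * π - π / 4 by push_cast; ring, Real.cos_two_pi_sub, Real.cos_pi_div_four]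
  constructor <;> nlinarith [sqrt_two_bounds.1, sqrt_two_bounds.2]

/-- `2 − 2cos(2π·15/16) = 0.152241… ∈ [0.1521, 0.1524]`. [folklore] -/
theorem twoSubTwoCos_15_16 :
    (0.1521 : ℝ) ≤ 2 - 2 * Real.cos (2 * π * ((15 : ℕ) : ℝ) / ((16 : ℕ) : ℝ)) ∧
    2 - 2 * Real.cos (2 * π * ((15 : ℕ) : ℝ) / ((16 : ℕ) : ℝ)) ≤ 0.1524 := by
  rw [show (2 * π * ((15 : ℕ) : ℝ) / ((16 : ℕ) : ℝ) : ℝ) = 2 * π - π / 8 by push_cast; ring, Real.cos_two_pi_sub, Real.cos_pi_div_eight]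
  constructor <;> nlinarith [sqrt_two_add_sqrt_two_bounds.1, sqrt_two_add_sqrt_two_bounds.2]

end Summit.Ventures.WeilGRH
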